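import Summits.QuantumFields.YangMills.Theorems.ConvexGribovBodyCovarianceBoundDefsC
import Summits.QuantumFields.YangMills.Theorems.ConvexGribovBodyCovarianceBoundStubProjSplit
import HarnessLib

/-!
# Stub `stub_lieProjControl` for the crux `CovarianceBound` (stmt-QuantumFields-8780), line `Sketch`
# (ideator 4, twist-stiffness envelope)

Route `QuantumFields/YangMills/ConvexGribovBody`, crux
`Summit.QuantumFields.YangMills.Theses.ConvexGribovBody.CovarianceBound`, skeleton line `Sketch`
(continuation lead c4). This file proves the registered stub `stub_lieProjControl`: control of the
squared Frobenius norm of the `𝔤`-projection `P_𝔤 A = r.lieProj A` by the pairings of `A` with the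
one-parameter generators `X ∈ r.lieAlgCarrier` (whose real span is `𝔤 = r.lieAlg`). It is pure
finite-dimensional linear algebra:

1. for skew-Hermitian `X`, `⟨A, X⟩ = Re tr(A Xᴴ) = -Re tr(A X)` and `⟨P_𝔤 A, X⟩ = ⟨A, X⟩` for `X ∈ 𝔤`;
2. the carrier contains a finite linearly independent family `t` spanning `𝔤` (`M_N(ℂ)` is a
   finite-dimensional real space), and the pairing map `T : 𝔤 → ℝ^t`, `Y ↦ (⟨x, Y⟩)_{x ∈ t}` is
   injective by positive definiteness of `Re tr(X Yᴴ)`, hence has a linear left inverse `S`;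
3. `Y = Σ_{x ∈ t} (T Y)_x • S(e_x)`, and a bilinear form on a finite linear combination is bounded by
   `(Σ_{ik} |⟨mᵢ, mₖ⟩|) Σᵢ cᵢ²`; with `Y = P_𝔤 A` and `(T Y)_x² = (Re tr(A x))² ≤ b ‖x‖²_F` this gives
   `‖P_𝔤 A‖²_F ≤ (C₀ Σ_{x ∈ t} ‖x‖²_F) · b`.

Helper lemmas live in the sub-namespace `LieProjControl` (`froSq X = ⟨X, X⟩` is reused from
`…StubProjSplit`, `ProjSplit.froSq_eq_hsForm`). No named facts are used.
-/

set_option autoImplicit false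

noncomputable section

namespace Summit.QuantumFields.YangMills.Cruxes.CovarianceBound.TwistStiffness

open scoped BigOperators Matrix ComplexConjugate
open MeasureTheory Literature.MathematicalPhysics.QuantumFieldTheory
open Summit.QuantumFields.YangMills.Cruxes.CovarianceBound.SupportWindow

variable {G : Type} [Group G] [TopologicalSpace G]

/-! ### Helper lemmas (sub-namespace `LieProjControl`) -/

namespace LieProjControl

/-- For skew-Hermitian `X`: `⟨A, X⟩ = -Re tr(A X)`. [folklore] -/
theorem hsForm_eq_neg_re_trace {N : ℕ} (A : Matrix (Fin N) (Fin N) ℂ)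
    {X : Matrix (Fin N) (Fin N) ℂ} (hX : star X = -X) : hsForm N A X = -(A * X).trace.re := by
  rw [hsForm_apply, ← Matrix.star_eq_conjTranspose, hX, Matrix.mul_neg, Matrix.trace_neg,
    Complex.neg_re]

/-- `⟨P_𝔤 A, Y⟩ = ⟨A, Y⟩` for `Y ∈ 𝔤` (`A - P_𝔤 A ⊥ 𝔤`). [folklore] -/
theorem hsForm_lieProj_left (r : LatticeRep G) (A : Matrix (Fin r.N) (Fin r.N) ℂ)
    {Y : Matrix (Fin r.N) (Fin r.N) ℂ} (hY : Y ∈ r.lieAlg) :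
    hsForm r.N (r.lieProj A) Y = hsForm r.N A Y := by
  have h := r.hsForm_sub_lieProj (X := A) hY
  rw [map_sub, sub_eq_zero] at h
  rw [hsForm_comm (r.lieProj A) Y, ← h]
  exact hsForm_comm Y A

/-- Positive definiteness on a span: an element of `span s` pairing to zero with every element of
`s` vanishes. [folklore] -/
theorem eq_zero_of_forall_hsForm_eq_zero {N : ℕ} {s : Set (Matrix (Fin N) (Fin N) ℂ)}
    {Y : Matrix (Fin N) (Fin N) ℂ} (hY : Y ∈ Submodule.span ℝ s)
    (h : ∀ x ∈ s, hsForm N x Y = 0) : Y = 0 := by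
  have hle : Submodule.span ℝ s ≤ LinearMap.ker (hsForm N Y) :=
    Submodule.span_le.2 fun x hx => LinearMap.mem_ker.2 ((hsForm_comm Y x).trans (h x hx))
  exact hsForm_self_eq_zero.1 (LinearMap.mem_ker.1 (hle hY))

/-- A real bilinear form on a finite linear combination is bounded by the sum of the squares of the
coefficients: `B(Σ cᵢ mᵢ, Σ cᵢ mᵢ) ≤ (Σᵢₖ |B(mᵢ, mₖ)|) · Σᵢ cᵢ²`. [folklore] -/
theorem bilin_sum_smul_le {ι V : Type*} [Fintype ι] [AddCommGroup V] [Module ℝ V]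
    (B : LinearMap.BilinForm ℝ V) (m : ι → V) (c : ι → ℝ) :
    B (∑ i, c i • m i) (∑ i, c i • m i) ≤ (∑ i, ∑ k, |B (m i) (m k)|) * ∑ i, c i ^ 2 := by
  have hexp :
      B (∑ i, c i • m i) (∑ i, c i • m i) = ∑ i, ∑ k, c i * (c k * B (m i) (m k)) := by
    simp only [map_sum, map_smul, LinearMap.sum_apply, LinearMap.smul_apply, smul_eq_mul,
      Finset.mul_sum]
    rw [Finset.sum_comm]
    exact Finset.sum_congr rfl fun i _ => Finset.sum_congr rfl fun k _ => by ring
  rw [hexp, Finset.sum_mul]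
  refine Finset.sum_le_sum fun i _ => ?_
  rw [Finset.sum_mul]
  refine Finset.sum_le_sum fun k _ => ?_
  have hi : c i ^ 2 ≤ ∑ l, c l ^ 2 :=
    Finset.single_le_sum (f := fun l => c l ^ 2) (fun l _ => sq_nonneg (c l)) (Finset.mem_univ i)
  have hk : c k ^ 2 ≤ ∑ l, c l ^ 2 :=
    Finset.single_le_sum (f := fun l => c l ^ 2) (fun l _ => sq_nonneg (c l)) (Finset.mem_univ k)
  have hprod : |c i| * |c k| ≤ ∑ l, c l ^ 2 := by
    nlinarith [two_mul_le_add_sq (|c i|) (|c k|), sq_abs (c i), sq_abs (c k)]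
  calc c i * (c k * B (m i) (m k)) ≤ |c i * (c k * B (m i) (m k))| := le_abs_self _
    _ = |c i| * |c k| * |B (m i) (m k)| := by rw [abs_mul, abs_mul, mul_assoc]
    _ ≤ (∑ l, c l ^ 2) * |B (m i) (m k)| := mul_le_mul_of_nonneg_right hprod (abs_nonneg _)
    _ = |B (m i) (m k)| * ∑ l, c l ^ 2 := mul_comm _ _

/-- **Norm control on `𝔤` by finitely many carrier pairings.** There are a finite family
`x : ι → M_N(ℂ)` of carrier elements and a constant `C₀ ≥ 0` with `‖Y‖²_F ≤ C₀ Σᵢ ⟨xᵢ, Y⟩²` for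
every `Y ∈ 𝔤`. [folklore] -/
theorem exists_froSq_le_sum_sq (r : LatticeRep G) :
    ∃ (ι : Type) (_ : Fintype ι) (x : ι → Matrix (Fin r.N) (Fin r.N) ℂ) (C₀ : ℝ),
      (∀ i, x i ∈ r.lieAlgCarrier) ∧ 0 ≤ C₀ ∧
        ∀ y : r.lieAlg, froSq (y : Matrix (Fin r.N) (Fin r.N) ℂ) ≤
          C₀ * ∑ i, (hsForm r.N (x i) (y : Matrix (Fin r.N) (Fin r.N) ℂ)) ^ 2 := by
  classical
  obtain ⟨t, ht_sub, ht_span, ht_li⟩ := exists_linearIndependent ℝ r.lieAlgCarrier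
  haveI : Fintype t := ht_li.setFinite.fintype
  -- the pairing map `T : 𝔤 → ℝ^t`
  let T : r.lieAlg →ₗ[ℝ] (t → ℝ) := LinearMap.pi fun x : t =>
    (hsForm r.N (x : Matrix (Fin r.N) (Fin r.N) ℂ)).comp r.lieAlg.subtype
  have hT : ∀ (y : r.lieAlg) (x : t),
      T y x = hsForm r.N (x : Matrix (Fin r.N) (Fin r.N) ℂ) y := fun y x => rfl
  have hker : LinearMap.ker T = ⊥ := by
    refine LinearMap.ker_eq_bot'.2 fun y hy => ?_
    have hy' : (y : Matrix (Fin r.N) (Fin r.N) ℂ) ∈ Submodule.span ℝ t := by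
      rw [ht_span]; exact y.2
    exact Subtype.ext (eq_zero_of_forall_hsForm_eq_zero hy' fun x hx => by
      rw [← hT y ⟨x, hx⟩, hy]; rfl)
  obtain ⟨S, hS⟩ := T.exists_leftInverse_of_injective hker
  -- the images of the coordinate vectors
  let m : t → Matrix (Fin r.N) (Fin r.N) ℂ := fun x =>
    (S (fun j => if x = j then (1 : ℝ) else 0) : Matrix (Fin r.N) (Fin r.N) ℂ)
  refine ⟨t, inferInstance, Subtype.val, ∑ i, ∑ k, |hsForm r.N (m i) (m k)|,
    fun x => ht_sub x.2, by positivity, fun y => ?_⟩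
  have h1 : S (T y) = y := by rw [← LinearMap.comp_apply, hS, LinearMap.id_apply]
  have h2 : ((S (T y) : r.lieAlg) : Matrix (Fin r.N) (Fin r.N) ℂ) = ∑ x, T y x • m x := by
    rw [LinearMap.pi_apply_eq_sum_univ S (T y), Submodule.coe_sum]
    rfl
  rw [h1] at h2
  calc froSq (y : Matrix (Fin r.N) (Fin r.N) ℂ)
        = hsForm r.N (∑ x, T y x • m x) (∑ x, T y x • m x) := by
          rw [ProjSplit.froSq_eq_hsForm, ← h2]
    _ ≤ (∑ i, ∑ k, |hsForm r.N (m i) (m k)|) * ∑ x, (T y x) ^ 2 :=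
          bilin_sum_smul_le _ m (T y)
    _ = (∑ i, ∑ k, |hsForm r.N (m i) (m k)|) *
          ∑ x : t, (hsForm r.N (x : Matrix (Fin r.N) (Fin r.N) ℂ) y) ^ 2 := rfl

end LieProjControl

/-! ### The registered stub -/

/-- **Stub 2 — carrier pairings control the `𝔤`-projection** (finite-dimensional linear algebra:
`𝔤 = span(carrier)` is finite-dimensional, `Re tr(· ·ᴴ)` is positive definite, so finitely many
carrier directions bound `‖P_𝔤 A‖²_F`): there is `C = C(r) ≥ 0` such that
`(Re tr(A X))² ≤ b ‖X‖²_F` for all `X ∈ r.lieAlgCarrier` implies `‖P_𝔤 A‖²_F ≤ C b`. -/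
theorem stub_lieProjControl (r : LatticeRep G) :
    ∃ C : ℝ, 0 ≤ C ∧ ∀ (A : Matrix (Fin r.N) (Fin r.N) ℂ) (b : ℝ), 0 ≤ b →
      (∀ X ∈ r.lieAlgCarrier, ((A * X).trace.re) ^ 2 ≤ b * froSq X) →
        froSq (r.lieProj A) ≤ C * b := by
  obtain ⟨ι, _, x, C₀, hx, hC₀, hbound⟩ := LieProjControl.exists_froSq_le_sum_sq r
  refine ⟨C₀ * ∑ i, froSq (x i), mul_nonneg hC₀ (Finset.sum_nonneg fun i _ => ?_),
    fun A b _ h => ?_⟩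
  · unfold froSq; positivity
  · have hpair : ∀ i, (hsForm r.N (x i) (r.lieProj A)) ^ 2 = ((A * x i).trace.re) ^ 2 := by
      intro i
      rw [hsForm_comm,
        LieProjControl.hsForm_lieProj_left r A (r.lieAlgCarrier_subset_lieAlg (hx i)),
        LieProjControl.hsForm_eq_neg_re_trace A (hx i).1, neg_sq]
    calc froSq (r.lieProj A) ≤ C₀ * ∑ i, (hsForm r.N (x i) (r.lieProj A)) ^ 2 :=
          hbound ⟨r.lieProj A, r.lieProj_mem A⟩
      _ = C₀ * ∑ i, ((A * x i).trace.re) ^ 2 := by simp only [hpair]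
      _ ≤ C₀ * ∑ i, b * froSq (x i) :=
          mul_le_mul_of_nonneg_left (Finset.sum_le_sum fun i _ => h (x i) (hx i)) hC₀
      _ = C₀ * (∑ i, froSq (x i)) * b := by rw [← Finset.mul_sum]; ring

end Summit.QuantumFields.YangMills.Cruxes.CovarianceBound.TwistStiffness

end
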